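import Literature.AlgebraicGeometry.ComplexMultiplication.CyclotomicFermatCMTypesThreePowerLevelIsogenies
import HarnessLib

/-!
# Koblitz–Rohrlich, THEOREM 3 (`N = 3ⁿ`): the non-obvious coincidences `H_{(3ᵐ⁺¹, 3ⁿ⁻¹−2·3ᵐ, 2·3ⁿ⁻¹−3ᵐ)} = H_{(3ᵐ, 3ⁿ⁻¹−2·3ᵐ, 2·3ⁿ⁻¹+3ᵐ)}`
# hold for EVERY `n ≥ 2` and `0 ≤ m ≤ n − 2`, and are not obvious

Layer `Literature/AlgebraicGeometry/ComplexMultiplication`, namespace `…ComplexMultiplication.CyclotomicFermatCMType`; sequel of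
`CyclotomicFermatCMTypesThreePowerLevelIsogenies` (the same coincidences at `N = 9, 27, 81` by kernel enumeration, and the §4 Proposition in
full at `N = 9`).  THEOREMS ONLY (no definition, no named fact, no `sorry`); no kernel `decide` — the level is a variable.

THE SOURCE.  N. Koblitz, D. Rohrlich, *Simple factors in the Jacobian of a Fermat curve*, Canad. J. Math. **30** (1978) 1183–1205, p. 1186:
"THEOREM 3. Suppose `N = 3ⁿ`.  Then the only isogenies apart from the obvious ones are between pairs of lattices corresponding to the triples
`(3ᵐ, 3ⁿ⁻¹ − 2(3ᵐ), 2(3ⁿ⁻¹) + 3ᵐ)` and `(3ᵐ⁺¹, 3ⁿ⁻¹ − 2(3ᵐ), 2(3ⁿ⁻¹) − 3ᵐ)` for `0 ≤ m ≤ n − 2`", with §1 (p. 1184): `L_{r,s}` and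
`L_{r′,s′}` are identical lattices when `H_{r,s} = H_{r′,s′}`, `H_{r,s,t} = {h : ⟨hr⟩ + ⟨hs⟩ + ⟨ht⟩ = N}`; "obvious" (p. 1185) = `τ′ ∼ τ`, a
multiple of a permutation.  §4 (pp. 1198–1201) proves the converse ("the only isogenies").

WHAT IS PROVED — the EXISTENCE half of Theorem 3 at every level `3ⁿ`: with `T = 3^{n−1−m}` and `N = 3ⁿ = 3ᵐ·3T`, for every unit `x`
modulo `N` the residues satisfy the identity `⟨3ᵐ⁺¹x⟩ + ⟨3ᵐ(2T − 1)x⟩ = ⟨3ᵐx⟩ + ⟨3ᵐ(2T + 1)x⟩` (§2; at `m = 0` this is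
`⟨3x⟩ + ⟨(2T−1)x⟩ = x + ⟨(2T+1)x⟩`, an elementary case analysis in `x mod 3 ∈ {1, 2}` and `x <> T, 2T`, §1), whence the two membership
conditions `⟨3ᵐ⁺¹x⟩ + ⟨(3ⁿ⁻¹ − 2·3ᵐ)x⟩ + ⟨(2·3ⁿ⁻¹ − 3ᵐ)x⟩ = N` and `⟨3ᵐx⟩ + ⟨(3ⁿ⁻¹ − 2·3ᵐ)x⟩ + ⟨(2·3ⁿ⁻¹ + 3ᵐ)x⟩ = N` agree:
**`fermatCMType_threePow_eq`** (§3).  The coincidence is NOT obvious (§4, **`not_exists_multiset_eq_threePow`**): reduced modulo `3`, the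
triple `(3ᵐ⁺¹, 3ⁿ⁻¹ − 2·3ᵐ, 2·3ⁿ⁻¹ − 3ᵐ)` at `m = 0` is `(0, 1, 2)` while every multiple `u·(1, 3ⁿ⁻¹ − 2, 2·3ⁿ⁻¹ + 1)` is `(ū, ū, ū)`.
§5 specialises the general theorem at `N = 243, 729` (out of reach of the sibling's kernel `decide`; its instances at `9, 27, 81` are
special cases too and are not restated).

## Honest column / NOT here

* Only the existence half; "the only isogenies" (§4 of the paper, pp. 1198–1201) is NOT typed beyond the sibling's `N = 9`.
* The identity of §1 is ours (K–R's §4 proves the Proposition by a different bookkeeping); it is stated for `T` divisible by `3` and units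
  `x`, which is exactly what the level `3ⁿ`, `n ≥ m + 2`, supplies.
* As in the sibling, "isogeny of lattices" is typed as equality of the residue sets `H_τ`; Jacobian factors are not constructed.

## References

* [KoblitzRohrlich1978] N. Koblitz, D. Rohrlich, Canad. J. Math. 30 (1978) 1183–1205: Theorem 3 (p. 1186), §1 (pp. 1184–1185), §4 (p. 1198).

## Provenance

Cell `pub-hodgecm2` (COR-CM), literature seat `lit-deligne-3` gen 36 (claim KR78-THM3-COINCIDENCES-ALL-N; count-neutral, own lane).
-/

open NumberField

namespace Literature.AlgebraicGeometry.ComplexMultiplication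

open Literature.AlgebraicGeometry.HodgeTheory

namespace CyclotomicFermatCMType

/-! ## §1 The residue identity `⟨3x⟩ + ⟨(2T−1)x⟩ = x + ⟨(2T+1)x⟩` modulo `3T` (`3 ∣ T`, `3 ∤ x`) -/

section Residues

/-- `y % m = r` from `r + m·q = y`, `r < m`. [folklore] -/
private theorem mod_eq_of_add_mul_eq {m r q y : ℕ} (hm : 0 < m) (h : r + m * q = y) (hr : r < m) : y % m = r :=
  ((Nat.div_mod_unique hm).2 ⟨h, hr⟩).2

/-- `(b·n + r) % n = r % n`. [folklore] -/
private theorem mul_add_mod_right (b n r : ℕ) : (b * n + r) % n = r % n := by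
  rw [Nat.add_comm, Nat.add_mul_mod_self_right]

/-- **The residue identity.**  For `T` divisible by `3` and `x < 3T` with `3 ∤ x`:
`(3x mod 3T) + (x(2T − 1) mod 3T) = x + (x(2T + 1) mod 3T)` — both sides equal `2x + 2T`, `2x − T`, `2x − T` (`x ≡ 1 (3)`, `x` below `T`,
between `T` and `2T`, above `2T`) resp. `2x + T`, `2x + T`, `2x − 2T` (`x ≡ 2 (3)`). [cite: KoblitzRohrlich1978, Theorem 3 (p. 1186)] -/
theorem three_mul_mod_add_mul_mod_eq {T x : ℕ} (hT : 3 ∣ T) (hx3 : x % 3 ≠ 0) (hx : x < 3 * T) :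
    (3 * x) % (3 * T) + (x * (2 * T - 1)) % (3 * T) = x + (x * (2 * T + 1)) % (3 * T) := by
  obtain ⟨T', hT'⟩ := hT
  have hpos : 0 < 3 * T := by omega
  -- `x = 3a + ρ`, `ρ ∈ {1, 2}`
  set a := x / 3 with ha
  set ρ := x % 3 with hρ
  have hxe : x = 3 * a + ρ := (Nat.div_add_mod x 3).symm
  have hρ12 : ρ = 1 ∨ ρ = 2 := by omega
  -- `x(2T + 1) = 2a·(3T) + (2ρT + x)` and `x(2T − 1) + x = 2a·(3T) + 2ρT`
  have eA : x * (2 * T + 1) = 2 * a * (3 * T) + (2 * ρ * T + x) := by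
    rw [hxe]
    ring
  have mA : (x * (2 * T + 1)) % (3 * T) = (2 * ρ * T + x) % (3 * T) := by
    rw [eA, mul_add_mod_right]
  have e1 : x * (2 * T - 1) + x = 2 * a * (3 * T) + 2 * ρ * T := by
    have h' : x * (2 * T - 1) + x = x * (2 * T - 1 + 1) := by ring
    rw [h', show 2 * T - 1 + 1 = 2 * T by omega, hxe]
    ring
  -- `x ≠ T, 2T` (both are multiples of `3`)
  have hxT : x ≠ T := by omega
  have hx2T : x ≠ 2 * T := by omega
  rcases hρ12 with hρ1 | hρ2
  · -- `x ≡ 1 (mod 3)`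
    rw [hρ1] at mA e1
    rcases Nat.lt_or_ge x T with h1 | h1
    · -- `x < T`
      have m3 : (3 * x) % (3 * T) = 3 * x := Nat.mod_eq_of_lt (by omega)
      have eB : x * (2 * T - 1) = 2 * a * (3 * T) + (2 * T - x) := by omega
      have mB : (x * (2 * T - 1)) % (3 * T) = 2 * T - x := by
        rw [eB, mul_add_mod_right]
        exact Nat.mod_eq_of_lt (by omega)
      have mA' : (2 * 1 * T + x) % (3 * T) = 2 * T + x := Nat.mod_eq_of_lt (by omega)
      rw [m3, mB, mA, mA']
      omega
    · rcases Nat.lt_or_ge x (2 * T) with h2 | h2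
      · -- `T < x < 2T`
        have m3 : (3 * x) % (3 * T) = 3 * x - 3 * T := mod_eq_of_add_mul_eq hpos (q := 1) (by omega) (by omega)
        have eB : x * (2 * T - 1) = 2 * a * (3 * T) + (2 * T - x) := by omega
        have mB : (x * (2 * T - 1)) % (3 * T) = 2 * T - x := by
          rw [eB, mul_add_mod_right]
          exact Nat.mod_eq_of_lt (by omega)
        have mA' : (2 * 1 * T + x) % (3 * T) = x - T := mod_eq_of_add_mul_eq hpos (q := 1) (by omega) (by omega)
        rw [m3, mB, mA, mA']
        omega
      · -- `2T < x < 3T`: here `a ≥ 1` and `x(2T − 1) = (2a − 1)·(3T) + (5T − x)`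
        have m3 : (3 * x) % (3 * T) = 3 * x - 6 * T := mod_eq_of_add_mul_eq hpos (q := 2) (by omega) (by omega)
        have ha1 : 1 ≤ a := by omega
        have f : (2 * a - 1) * (3 * T) + 3 * T = 2 * a * (3 * T) := by
          obtain ⟨a', ha'⟩ : ∃ a', a = a' + 1 := ⟨a - 1, by omega⟩
          rw [ha', show 2 * (a' + 1) - 1 = 2 * a' + 1 by omega]
          ring
        have eB : x * (2 * T - 1) = (2 * a - 1) * (3 * T) + (5 * T - x) := by omega
        have mB : (x * (2 * T - 1)) % (3 * T) = 5 * T - x := by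
          rw [eB, mul_add_mod_right]
          exact Nat.mod_eq_of_lt (by omega)
        have mA' : (2 * 1 * T + x) % (3 * T) = x - T := mod_eq_of_add_mul_eq hpos (q := 1) (by omega) (by omega)
        rw [m3, mB, mA, mA']
        omega
  · -- `x ≡ 2 (mod 3)`: `x ≤ 4T`, so `x(2T − 1) = 2a·(3T) + (4T − x)`
    rw [hρ2] at mA e1
    have eB : x * (2 * T - 1) = 2 * a * (3 * T) + (4 * T - x) := by omega
    have mB0 : (x * (2 * T - 1)) % (3 * T) = (4 * T - x) % (3 * T) := by rw [eB, mul_add_mod_right]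
    rcases Nat.lt_or_ge x T with h1 | h1
    · -- `x < T`
      have m3 : (3 * x) % (3 * T) = 3 * x := Nat.mod_eq_of_lt (by omega)
      have mB : (4 * T - x) % (3 * T) = T - x := mod_eq_of_add_mul_eq hpos (q := 1) (by omega) (by omega)
      have mA' : (2 * 2 * T + x) % (3 * T) = T + x := mod_eq_of_add_mul_eq hpos (q := 1) (by omega) (by omega)
      rw [m3, mB0, mB, mA, mA']
      omega
    · rcases Nat.lt_or_ge x (2 * T) with h2 | h2
      · -- `T < x < 2T`
        have m3 : (3 * x) % (3 * T) = 3 * x - 3 * T := mod_eq_of_add_mul_eq hpos (q := 1) (by omega) (by omega)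
        have mB : (4 * T - x) % (3 * T) = 4 * T - x := Nat.mod_eq_of_lt (by omega)
        have mA' : (2 * 2 * T + x) % (3 * T) = T + x := mod_eq_of_add_mul_eq hpos (q := 1) (by omega) (by omega)
        rw [m3, mB0, mB, mA, mA']
        omega
      · -- `2T < x < 3T`
        have m3 : (3 * x) % (3 * T) = 3 * x - 6 * T := mod_eq_of_add_mul_eq hpos (q := 2) (by omega) (by omega)
        have mB : (4 * T - x) % (3 * T) = 4 * T - x := Nat.mod_eq_of_lt (by omega)
        have mA' : (2 * 2 * T + x) % (3 * T) = x - 2 * T := mod_eq_of_add_mul_eq hpos (q := 2) (by omega) (by omega)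
        rw [m3, mB0, mB, mA, mA']
        omega

/-- **The identity scaled by `3ᵐ`**: for `T > 0` divisible by `3`, `x % 3 ≠ 0` (any `x`), with `N = 3ᵐ·(3T)`,
`(3ᵐ⁺¹x mod N) + (3ᵐ(2T−1)x mod N) = (3ᵐx mod N) + (3ᵐ(2T+1)x mod N)` (reduce `x` modulo `3T` and multiply §1's identity by `3ᵐ`).
[cite: KoblitzRohrlich1978, Theorem 3 (p. 1186)] -/
theorem pow_mul_mod_identity {T x m : ℕ} (hT : 3 ∣ T) (hT0 : 0 < T) (hx3 : x % 3 ≠ 0) :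
    (x * (3 ^ m * 3)) % (3 ^ m * (3 * T)) + (x * (3 ^ m * (2 * T - 1))) % (3 ^ m * (3 * T)) =
      (x * 3 ^ m) % (3 ^ m * (3 * T)) + (x * (3 ^ m * (2 * T + 1))) % (3 ^ m * (3 * T)) := by
  have h3T : 0 < 3 * T := by omega
  -- reduce `x` modulo `3T`
  set x' := x % (3 * T) with hx'
  have hx'3 : x' % 3 ≠ 0 := by
    rw [hx', Nat.mod_mod_of_dvd x (dvd_mul_right 3 T)]
    exact hx3
  have hx'lt : x' < 3 * T := Nat.mod_lt _ h3T
  have key := three_mul_mod_add_mul_mod_eq hT hx'3 hx'lt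
  -- each residue modulo `3ᵐ·(3T)` is `3ᵐ` times a residue modulo `3T`
  have r1 : (x * (3 ^ m * 3)) % (3 ^ m * (3 * T)) = 3 ^ m * ((3 * x') % (3 * T)) := by
    rw [show x * (3 ^ m * 3) = 3 ^ m * (3 * x) by ring, Nat.mul_mod_mul_left, Nat.mul_mod, hx',
      Nat.mod_eq_of_lt (show 3 < 3 * T by omega)]
  have r2 : (x * (3 ^ m * (2 * T - 1))) % (3 ^ m * (3 * T)) = 3 ^ m * ((x' * (2 * T - 1)) % (3 * T)) := by
    rw [show x * (3 ^ m * (2 * T - 1)) = 3 ^ m * (x * (2 * T - 1)) by ring, Nat.mul_mod_mul_left, Nat.mul_mod x, hx',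
      Nat.mod_eq_of_lt (show 2 * T - 1 < 3 * T by omega)]
  have r3 : (x * 3 ^ m) % (3 ^ m * (3 * T)) = 3 ^ m * x' := by
    rw [mul_comm x, Nat.mul_mod_mul_left]
  have r4 : (x * (3 ^ m * (2 * T + 1))) % (3 ^ m * (3 * T)) = 3 ^ m * ((x' * (2 * T + 1)) % (3 * T)) := by
    rw [show x * (3 ^ m * (2 * T + 1)) = 3 ^ m * (x * (2 * T + 1)) by ring, Nat.mul_mod_mul_left, Nat.mul_mod x, hx',
      Nat.mod_eq_of_lt (show 2 * T + 1 < 3 * T by omega)]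
  rw [r1, r2, r3, r4, ← mul_add, ← mul_add, key]

end Residues

/-! ## §2 The residues of the two triples at level `3ⁿ` -/

section Level

variable {n m : ℕ}

/-- `3ⁿ = 3ᵐ·(3·3^{n−1−m})` and the entries of the two triples as multiples of `3ᵐ` (`m + 2 ≤ n`). [folklore] -/
private theorem level_arith (hmn : m + 2 ≤ n) :
    3 ^ n = 3 ^ m * (3 * 3 ^ (n - 1 - m)) ∧ 3 ^ (m + 1) = 3 ^ m * 3 ∧
      2 * 3 ^ (n - 1) - 3 ^ m = 3 ^ m * (2 * 3 ^ (n - 1 - m) - 1) ∧ 2 * 3 ^ (n - 1) + 3 ^ m = 3 ^ m * (2 * 3 ^ (n - 1 - m) + 1) ∧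
      3 ∣ 3 ^ (n - 1 - m) := by
  have h1 : 3 ^ n = 3 ^ m * (3 * 3 ^ (n - 1 - m)) := by
    rw [← pow_succ', ← pow_add]
    congr 1
    omega
  have h2 : 3 ^ (n - 1) = 3 ^ m * 3 ^ (n - 1 - m) := by
    rw [← pow_add]
    congr 1
    omega
  refine ⟨h1, pow_succ 3 m, ?_, ?_, dvd_pow_self 3 (by omega)⟩
  · rw [h2, Nat.mul_sub, mul_one, ← mul_assoc, mul_comm 2 (3 ^ m), mul_assoc]
  · rw [h2, mul_add, mul_one, ← mul_assoc, mul_comm 2 (3 ^ m), mul_assoc]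

/-- **The residue identity for the two triples of Theorem 3**: for `m + 2 ≤ n` and every unit `x` modulo `3ⁿ`,
`⟨3ᵐ⁺¹x⟩ + ⟨(2·3ⁿ⁻¹ − 3ᵐ)x⟩ = ⟨3ᵐx⟩ + ⟨(2·3ⁿ⁻¹ + 3ᵐ)x⟩` (residues in `[0, 3ⁿ)`). [cite: KoblitzRohrlich1978, Theorem 3 (p. 1186)] -/
theorem val_mul_add_val_mul_eq_threePow [NeZero (3 ^ n)] (hmn : m + 2 ≤ n) (x : ZMod (3 ^ n)) (hx : x.val.Coprime (3 ^ n)) :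
    (x * ((3 ^ (m + 1) : ℕ) : ZMod (3 ^ n))).val + (x * ((2 * 3 ^ (n - 1) - 3 ^ m : ℕ) : ZMod (3 ^ n))).val =
      (x * ((3 ^ m : ℕ) : ZMod (3 ^ n))).val + (x * ((2 * 3 ^ (n - 1) + 3 ^ m : ℕ) : ZMod (3 ^ n))).val := by
  obtain ⟨hN, h31, hsub, hadd, hdvd⟩ := level_arith hmn
  set T := 3 ^ (n - 1 - m) with hT
  have hT3 : 3 ≤ T := by
    rw [hT]
    calc 3 = 3 ^ 1 := (pow_one 3).symm
      _ ≤ 3 ^ (n - 1 - m) := Nat.pow_le_pow_right (by norm_num) (by omega)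
  have hm1 : 1 ≤ 3 ^ m := Nat.one_le_pow _ _ (by norm_num)
  -- the four multipliers are `< 3ⁿ`
  have hlt1 : 3 ^ (m + 1) < 3 ^ n := Nat.pow_lt_pow_right (by norm_num) (by omega)
  have hlt2 : 3 ^ m < 3 ^ n := Nat.pow_lt_pow_right (by norm_num) (by omega)
  have hlt3 : 2 * 3 ^ (n - 1) + 3 ^ m < 3 ^ n := by
    rw [hadd, hN]
    exact Nat.mul_lt_mul_of_pos_left (by omega) (by omega)
  have hlt4 : 2 * 3 ^ (n - 1) - 3 ^ m < 3 ^ n := by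
    rw [hsub, hN]
    exact Nat.mul_lt_mul_of_pos_left (by omega) (by omega)
  -- `3 ∤ x.val`
  have hx3 : x.val % 3 ≠ 0 := by
    intro h0
    have h3 : 3 ∣ Nat.gcd x.val (3 ^ n) := Nat.dvd_gcd (Nat.dvd_of_mod_eq_zero h0) (dvd_pow_self 3 (by omega))
    rw [hx] at h3
    exact absurd (Nat.le_of_dvd one_pos h3) (by norm_num)
  simp only [ZMod.val_mul, ZMod.val_natCast, Nat.mod_eq_of_lt hlt1, Nat.mod_eq_of_lt hlt2, Nat.mod_eq_of_lt hlt3,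
    Nat.mod_eq_of_lt hlt4]
  set X := x.val with hX
  rw [h31, hsub, hadd, hN]
  exact pow_mul_mod_identity hdvd (by omega) hx3

end Level

/-! ## §3 THEOREM 3, existence half, at EVERY level `3ⁿ` -/

section TheoremThree

variable {n m : ℕ}

/-- **THEOREM 3 — THE NON-OBVIOUS COINCIDENCES EXIST FOR EVERY `n`**: for `N = 3ⁿ` and `0 ≤ m ≤ n − 2`,
`H_{(3ᵐ⁺¹, 3ⁿ⁻¹ − 2·3ᵐ, 2·3ⁿ⁻¹ − 3ᵐ)} = H_{(3ᵐ, 3ⁿ⁻¹ − 2·3ᵐ, 2·3ⁿ⁻¹ + 3ᵐ)}` as residue sets modulo `3ⁿ` — the lattices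
`L_{(3ᵐ⁺¹, 3ⁿ⁻¹−2·3ᵐ, 2·3ⁿ⁻¹−3ᵐ)}` and `L_{(3ᵐ, 3ⁿ⁻¹−2·3ᵐ, 2·3ⁿ⁻¹+3ᵐ)}` coincide ("pairs of lattices corresponding to the triples …
for `0 ≤ m ≤ n − 2`"). [cite: KoblitzRohrlich1978, Theorem 3 (p. 1186) and §1 (p. 1184)] -/
theorem fermatCMType_threePow_eq [NeZero (3 ^ n)] (hmn : m + 2 ≤ n) :
    fermatCMType (3 ^ n) ((3 ^ (m + 1) : ℕ) : ZMod (3 ^ n)) ((3 ^ (n - 1) - 2 * 3 ^ m : ℕ) : ZMod (3 ^ n))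
        ((2 * 3 ^ (n - 1) - 3 ^ m : ℕ) : ZMod (3 ^ n)) =
      fermatCMType (3 ^ n) ((3 ^ m : ℕ) : ZMod (3 ^ n)) ((3 ^ (n - 1) - 2 * 3 ^ m : ℕ) : ZMod (3 ^ n))
        ((2 * 3 ^ (n - 1) + 3 ^ m : ℕ) : ZMod (3 ^ n)) := by
  ext x
  simp only [fermatCMType, Finset.mem_filter, Finset.mem_univ, true_and]
  constructor
  · rintro ⟨hc, hs⟩
    have h := val_mul_add_val_mul_eq_threePow hmn x hc
    exact ⟨hc, by omega⟩
  · rintro ⟨hc, hs⟩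
    have h := val_mul_add_val_mul_eq_threePow hmn x hc
    exact ⟨hc, by omega⟩

/-- **Theorem 3 at `m = 0`, every `n ≥ 2`**: `H_{(3, 3ⁿ⁻¹ − 2, 2·3ⁿ⁻¹ − 1)} = H_{(1, 3ⁿ⁻¹ − 2, 2·3ⁿ⁻¹ + 1)}` modulo `3ⁿ`
(the primitive pair; the pairs with `m ≥ 1` are its multiples by `3ᵐ`). [cite: KoblitzRohrlich1978, Theorem 3 (p. 1186) and §4 Proposition (p. 1198)] -/
theorem fermatCMType_threePow_eq_zero [NeZero (3 ^ n)] (hn : 2 ≤ n) :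
    fermatCMType (3 ^ n) 3 ((3 ^ (n - 1) - 2 : ℕ) : ZMod (3 ^ n)) ((2 * 3 ^ (n - 1) - 1 : ℕ) : ZMod (3 ^ n)) =
      fermatCMType (3 ^ n) 1 ((3 ^ (n - 1) - 2 : ℕ) : ZMod (3 ^ n)) ((2 * 3 ^ (n - 1) + 1 : ℕ) : ZMod (3 ^ n)) := by
  have h := fermatCMType_threePow_eq (n := n) (m := 0) (by omega)
  simp only [zero_add, pow_one, pow_zero, mul_one, Nat.cast_ofNat, Nat.cast_one] at h
  exact h

end TheoremThree

/-! ## §4 The coincidence is not obvious: `(3, 3ⁿ⁻¹ − 2, 2·3ⁿ⁻¹ − 1)` is no multiple of a permutation of `(1, 3ⁿ⁻¹ − 2, 2·3ⁿ⁻¹ + 1)` -/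

section NotObvious

variable {n : ℕ}

/-- Reduction modulo `3` of the entries: `3 ↦ 0`, `3ⁿ⁻¹ − 2 ↦ 1`, `2·3ⁿ⁻¹ − 1 ↦ 2`, `2·3ⁿ⁻¹ + 1 ↦ 1` (`n ≥ 2`). [folklore] -/
private theorem castHom_entries (hn : 2 ≤ n) :
    ZMod.castHom (dvd_pow_self 3 (by omega : n ≠ 0)) (ZMod 3) (3 : ZMod (3 ^ n)) = 0 ∧
      ZMod.castHom (dvd_pow_self 3 (by omega : n ≠ 0)) (ZMod 3) ((3 ^ (n - 1) - 2 : ℕ) : ZMod (3 ^ n)) = 1 ∧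
      ZMod.castHom (dvd_pow_self 3 (by omega : n ≠ 0)) (ZMod 3) ((2 * 3 ^ (n - 1) - 1 : ℕ) : ZMod (3 ^ n)) = 2 ∧
      ZMod.castHom (dvd_pow_self 3 (by omega : n ≠ 0)) (ZMod 3) ((2 * 3 ^ (n - 1) + 1 : ℕ) : ZMod (3 ^ n)) = 1 := by
  have hT : 3 ∣ 3 ^ (n - 1) := dvd_pow_self 3 (by omega)
  have hT3 : 3 ≤ 3 ^ (n - 1) := Nat.le_of_dvd (pow_pos (by norm_num) _) hT
  obtain ⟨T', hT'⟩ := hT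
  refine ⟨?_, ?_, ?_, ?_⟩
  · rw [show (3 : ZMod (3 ^ n)) = ((3 : ℕ) : ZMod (3 ^ n)) from (Nat.cast_ofNat).symm, map_natCast]
    exact (ZMod.natCast_eq_zero_iff 3 3).2 dvd_rfl
  · rw [map_natCast, show (1 : ZMod 3) = ((1 : ℕ) : ZMod 3) from Nat.cast_one.symm, ZMod.natCast_eq_natCast_iff']
    omega
  · rw [map_natCast, show (2 : ZMod 3) = ((2 : ℕ) : ZMod 3) from (Nat.cast_ofNat).symm, ZMod.natCast_eq_natCast_iff']
    omega
  · rw [map_natCast, show (1 : ZMod 3) = ((1 : ℕ) : ZMod 3) from Nat.cast_one.symm, ZMod.natCast_eq_natCast_iff']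
    omega

/-- **NOT OBVIOUS, for every `n ≥ 2`**: `(3, 3ⁿ⁻¹ − 2, 2·3ⁿ⁻¹ − 1)` is not a multiple `u·(1, 3ⁿ⁻¹ − 2, 2·3ⁿ⁻¹ + 1)` of a permutation
modulo `3ⁿ` (modulo `3` the first triple is `(0, 1, 2)`, the second `(ū, ū, ū)`), so the coincidence of §3 is NOT an "obvious isogeny".
[cite: KoblitzRohrlich1978, Theorem 3 (p. 1186) and §1 (p. 1185)] -/
theorem not_exists_multiset_eq_threePow (hn : 2 ≤ n) :
    ¬∃ u : ZMod (3 ^ n), ({3, ((3 ^ (n - 1) - 2 : ℕ) : ZMod (3 ^ n)), ((2 * 3 ^ (n - 1) - 1 : ℕ) : ZMod (3 ^ n))} :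
        Multiset (ZMod (3 ^ n))) =
      {u * 1, u * ((3 ^ (n - 1) - 2 : ℕ) : ZMod (3 ^ n)), u * ((2 * 3 ^ (n - 1) + 1 : ℕ) : ZMod (3 ^ n))} := by
  rintro ⟨u, hu⟩
  obtain ⟨e0, e1, e2, e1'⟩ := castHom_entries hn
  set φ := ZMod.castHom (dvd_pow_self 3 (by omega : n ≠ 0)) (ZMod 3) with hφ
  -- `3` and `3ⁿ⁻¹ − 2` both occur in the right-hand multiset
  have h0 : (3 : ZMod (3 ^ n)) ∈ ({u * 1, u * ((3 ^ (n - 1) - 2 : ℕ) : ZMod (3 ^ n)),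
      u * ((2 * 3 ^ (n - 1) + 1 : ℕ) : ZMod (3 ^ n))} : Multiset (ZMod (3 ^ n))) := by
    rw [← hu]
    simp
  have h1 : ((3 ^ (n - 1) - 2 : ℕ) : ZMod (3 ^ n)) ∈ ({u * 1, u * ((3 ^ (n - 1) - 2 : ℕ) : ZMod (3 ^ n)),
      u * ((2 * 3 ^ (n - 1) + 1 : ℕ) : ZMod (3 ^ n))} : Multiset (ZMod (3 ^ n))) := by
    rw [← hu]
    simp
  simp only [Multiset.insert_eq_cons, Multiset.mem_cons, Multiset.mem_singleton] at h0 h1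
  -- modulo `3`: `0 = ū` and `1 = ū`
  have hu0 : φ u = 0 := by
    rcases h0 with e | e | e
    · have h := congrArg φ e
      rw [map_mul, map_one, mul_one, e0] at h
      exact h.symm
    · have h := congrArg φ e
      rw [map_mul, e1, mul_one, e0] at h
      exact h.symm
    · have h := congrArg φ e
      rw [map_mul, e1', mul_one, e0] at h
      exact h.symm
  have hu1 : φ u = 1 := by
    rcases h1 with e | e | e
    · have h := congrArg φ e
      rw [map_mul, map_one, mul_one, e1] at h
      exact h.symm
    · have h := congrArg φ e
      rw [map_mul, e1, mul_one] at h
      exact h.symm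
    · have h := congrArg φ e
      rw [map_mul, e1, e1', mul_one] at h
      exact h.symm
  rw [hu0] at hu1
  exact absurd hu1 (by decide)

end NotObvious

/-! ## §5 Instances beyond the sibling's kernel enumerations: `N = 243, 729` -/

section Instances

/-- **`N = 243`** (`n = 5`, `m = 0`): `H_{(3, 79, 161)} = H_{(1, 79, 163)}` — beyond the sibling's kernel enumerations. [cite: KoblitzRohrlich1978, Theorem 3 (p. 1186)] -/
theorem fermatCMType_twoFortyThree_eq : fermatCMType 243 3 79 161 = fermatCMType 243 1 79 163 := by
  have h := fermatCMType_threePow_eq_zero (n := 5) (by norm_num)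
  norm_num at h
  exact h

/-- **`N = 729`** (`n = 6`, `m = 2`): `H_{(27, 225, 477)} = H_{(9, 225, 495)}`. [cite: KoblitzRohrlich1978, Theorem 3 (p. 1186)] -/
theorem fermatCMType_sevenTwentyNine_eq : fermatCMType 729 27 225 477 = fermatCMType 729 9 225 495 := by
  have h := fermatCMType_threePow_eq (n := 6) (m := 2) (by norm_num)
  norm_num at h
  exact h

end Instances

end CyclotomicFermatCMType

end Literature.AlgebraicGeometry.ComplexMultiplication
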